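import Mathlib
import Summits.Ventures.PercRepro2.CoinChainXACake

/-!
# The layer cakes of the AND-switch chain centred at every chain law
(blind cell PercRepro2, night-2 g26; proofs/NIGHT2-DARC.md §67.10)

`chain_tau_cake_R ρ`: the τ-cake of the world-1 gate `G¹ = ν·chainMix 1 c d'` centred at the
coin law `R_ρ = ν·chainMix ρ c d` (`ρ = 0`: `R⁰`; `ρ = 1`: `R¹`):
`mʸ (l0 g₁ − l1 g₀) ≤ m (l0 g₁₂ − l1 g₂)`;  `chain_tau_cake_G ρ`: centred at the gate law
`G_ρ = ν·chainMix ρ c d'` (`ρ = 0`: `G⁰`; `ρ = 1`: `G¹` itself, where it is FKG);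
`chain_sigma_cake_R`, `chain_sigma_cake_G`: the mirrors.  All four laws agree with `G¹` on the
entry-free ideal, so the ideal moments `m, mˣ, mʸ` are the same throughout.  Feed any of them to
`chain_XA'_of_cake` / `chain_XA'_of_cake_y`.
-/

namespace Summit.Ventures.PercRepro2.Coin

open Classical

section CakeLaws

variable {V : Type*} [DecidableEq V] {R : Type*} [Field R] [LinearOrder R] [IsStrictOrderedRing R]

/-- **THE τ-CAKE CENTRED AT THE COIN LAW `R_ρ`** (`chain_cross_holley` at `ρ`). -/
theorem chain_tau_cake_R (U ent ent' : Finset V) (ν c d d' : Finset V → R)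
    (ρ : R) (hρ0 : 0 ≤ ρ) (hρ1 : ρ ≤ 1) (hν0 : ∀ W, 0 ≤ ν W)
    (hν : ∀ s ⊆ U, ∀ t ⊆ U, ν s * ν t ≤ ν (s ∩ t) * ν (s ∪ t))
    (hc0 : ∀ W, 0 ≤ c W) (hd0 : ∀ W, 0 ≤ d W) (hd'0 : ∀ W, 0 ≤ d' W)
    (hdc : ∀ W, d W ≤ c W) (hd'c : ∀ W, d' W ≤ c W)
    (hcc : ∀ s t, c s * c t ≤ c (s ∩ t) * c (s ∪ t))
    (hd'd' : ∀ s t, d' s * d' t ≤ d' (s ∩ t) * d' (s ∪ t))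
    (hcd' : ∀ s t, c s * d' t ≤ c (s ∩ t) * d' (s ∪ t))
    (hdd' : ∀ s t, d s * d' t ≤ d (s ∩ t) * d' (s ∪ t))
    (hratio' : ∀ s t, s ⊆ t → d' s * c t ≤ c s * d' t)
    (x y : Finset V → R) (hx0 : ∀ W, 0 ≤ x W) (hy0 : ∀ W, 0 ≤ y W)
    (hxm : ∀ s t, x s ≤ x (s ∪ t)) (hym : ∀ s t, y s ≤ y (s ∪ t))
    (hmI : 0 < ∑ W ∈ U.powerset.filter (fun W => ¬ ∃ r ∈ ent ∪ ent', r ∈ W), ν W * c W)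
    :
    (∑ W ∈ U.powerset.filter (fun W => ¬ ∃ r ∈ ent ∪ ent', r ∈ W), ν W * c W * y W) * ((∑ W ∈ U.powerset, ν W * chainMix ent ent' ρ c d W) * (∑ W ∈ U.powerset, ν W * chainMix ent ent' 1 c d' W * x W) - (∑ W ∈ U.powerset, ν W * chainMix ent ent' ρ c d W * x W) * (∑ W ∈ U.powerset, ν W * chainMix ent ent' 1 c d' W)) ≤
      (∑ W ∈ U.powerset.filter (fun W => ¬ ∃ r ∈ ent ∪ ent', r ∈ W), ν W * c W) * ((∑ W ∈ U.powerset, ν W * chainMix ent ent' ρ c d W) * (∑ W ∈ U.powerset, ν W * chainMix ent ent' 1 c d' W * (x W * y W)) - (∑ W ∈ U.powerset, ν W * chainMix ent ent' ρ c d W * x W) * (∑ W ∈ U.powerset, ν W * chainMix ent ent' 1 c d' W * y W)):= by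
  have hm1' : ∀ W, 0 ≤ chainMix ent ent' 1 c d' W :=
    chainMix_nonneg ent ent' zero_le_one le_rfl hc0 hd'0
  have hmρ : ∀ W, 0 ≤ chainMix ent ent' ρ c d W := chainMix_nonneg ent ent' hρ0 hρ1 hc0 hd0
  have hL0 : ∀ W, 0 ≤ ν W * chainMix ent ent' ρ c d W := fun W => mul_nonneg (hν0 W) (hmρ W)
  have hG1_0 : ∀ W, 0 ≤ ν W * chainMix ent ent' 1 c d' W := fun W => mul_nonneg (hν0 W) (hm1' W)
  have hmix' := mixture_lsm ent ent' 1 zero_le_one le_rfl c d' hc0 hd'0 hd'c hcc hd'd' hcd' hratio'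
  have wMM : ∀ s ⊆ U, ∀ t ⊆ U, ν s * chainMix ent ent' 1 c d' s * (ν t * chainMix ent ent' 1 c d' t) ≤
      ν (s ∩ t) * chainMix ent ent' 1 c d' (s ∩ t) * (ν (s ∪ t) * chainMix ent ent' 1 c d' (s ∪ t)) := by
    intro s hs t ht
    calc ν s * chainMix ent ent' 1 c d' s * (ν t * chainMix ent ent' 1 c d' t)
        = (ν s * ν t) * (chainMix ent ent' 1 c d' s * chainMix ent ent' 1 c d' t) := by ring
      _ ≤ (ν (s ∩ t) * ν (s ∪ t)) *
            (chainMix ent ent' 1 c d' (s ∩ t) * chainMix ent ent' 1 c d' (s ∪ t)) :=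
          mul_le_mul (hν s hs t ht) (hmix' s t) (mul_nonneg (hm1' _) (hm1' _))
            (mul_nonneg (hν0 _) (hν0 _))
      _ = _ := by ring
  have wML : ∀ s ⊆ U, ∀ t ⊆ U, (∃ r ∈ ent ∪ ent', r ∈ s) →
      ν s * chainMix ent ent' 1 c d' s * (ν t * chainMix ent ent' ρ c d t) ≤
        ν (s ∩ t) * chainMix ent ent' ρ c d (s ∩ t) * (ν (s ∪ t) * chainMix ent ent' 1 c d' (s ∪ t)) := by
    intro s hs t ht hse
    have hsu : ∃ r ∈ ent ∪ ent', r ∈ s ∪ t := by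
      obtain ⟨r, hr, hrs⟩ := hse; exact ⟨r, hr, Finset.mem_union_left _ hrs⟩
    rw [chainMix_one_of_meet ent ent' c d' hse, chainMix_one_of_meet ent ent' c d' hsu]
    calc ν s * d' s * (ν t * chainMix ent ent' ρ c d t)
        = (ν s * ν t) * (d' s * chainMix ent ent' ρ c d t) := by ring
      _ ≤ (ν (s ∩ t) * ν (s ∪ t)) * (chainMix ent ent' ρ c d (s ∩ t) * d' (s ∪ t)) :=
          mul_le_mul (hν s hs t ht) (chain_cross_holley ent ent' ρ hρ0 hρ1 c d d' hdc hcd' hdd' hd'0 s t)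
            (mul_nonneg (hd'0 _) (hmρ _)) (mul_nonneg (hν0 _) (hν0 _))
      _ = _ := by ring
  -- the law has positive mass (it dominates the ideal)
  have hΛ : 0 < ∑ W ∈ U.powerset, ν W * chainMix ent ent' ρ c d W := by
    refine lt_of_lt_of_le hmI ?_
    have e : (∑ W ∈ U.powerset.filter (fun W => ¬ ∃ r ∈ ent ∪ ent', r ∈ W), ν W * c W) =
        ∑ W ∈ U.powerset.filter (fun W => ¬ ∃ r ∈ ent ∪ ent', r ∈ W),
          ν W * chainMix ent ent' ρ c d W :=
      Finset.sum_congr rfl fun W hW => by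
        rw [chainMix_of_not_meet ent ent' ρ c d (Finset.mem_filter.1 hW).2]
    rw [e]
    exact Finset.sum_le_sum_of_subset_of_nonneg (Finset.filter_subset _ _) fun W _ _ => hL0 W
  have hTC := tau_cake_of_holley U (ent ∪ ent') (fun W => ν W * chainMix ent ent' ρ c d W)
    (fun W => ν W * chainMix ent ent' 1 c d' W) x y hL0 hG1_0 hx0 hy0 hxm hym wMM wML hΛ
  beta_reduce at hTC
  have hfilt : U.powerset.filter (fun W => W ∩ (ent ∪ ent') = ∅) =
      U.powerset.filter (fun W => ¬ ∃ r ∈ ent ∪ ent', r ∈ W) :=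
    Finset.filter_congr fun W _ => inter_eq_empty_iff_not_meets (ent ∪ ent') W
  have hN : (∑ W ∈ U.powerset.filter (fun W => W ∩ (ent ∪ ent') = ∅),
      ν W * chainMix ent ent' 1 c d' W) =
      ∑ W ∈ U.powerset.filter (fun W => ¬ ∃ r ∈ ent ∪ ent', r ∈ W), ν W * c W := by
    rw [hfilt]
    exact Finset.sum_congr rfl fun W hW => by
      rw [chainMix_of_not_meet ent ent' 1 c d' (Finset.mem_filter.1 hW).2]
  have hNy : (∑ W ∈ U.powerset.filter (fun W => W ∩ (ent ∪ ent') = ∅),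
      ν W * chainMix ent ent' 1 c d' W * y W) =
      ∑ W ∈ U.powerset.filter (fun W => ¬ ∃ r ∈ ent ∪ ent', r ∈ W), ν W * c W * y W := by
    rw [hfilt]
    exact Finset.sum_congr rfl fun W hW => by
      rw [chainMix_of_not_meet ent ent' 1 c d' (Finset.mem_filter.1 hW).2]
  rw [hN, hNy] at hTC
  exact hTC

/-- **THE τ-CAKE CENTRED AT THE GATE LAW `G_ρ`** (`chain_cross_holley` at `ρ` with `d := d'`). -/
theorem chain_tau_cake_G (U ent ent' : Finset V) (ν c d' : Finset V → R)
    (ρ : R) (hρ0 : 0 ≤ ρ) (hρ1 : ρ ≤ 1) (hν0 : ∀ W, 0 ≤ ν W)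
    (hν : ∀ s ⊆ U, ∀ t ⊆ U, ν s * ν t ≤ ν (s ∩ t) * ν (s ∪ t))
    (hc0 : ∀ W, 0 ≤ c W) (hd'0 : ∀ W, 0 ≤ d' W)
    (hd'c : ∀ W, d' W ≤ c W)
    (hcc : ∀ s t, c s * c t ≤ c (s ∩ t) * c (s ∪ t))
    (hd'd' : ∀ s t, d' s * d' t ≤ d' (s ∩ t) * d' (s ∪ t))
    (hcd' : ∀ s t, c s * d' t ≤ c (s ∩ t) * d' (s ∪ t))
    (hratio' : ∀ s t, s ⊆ t → d' s * c t ≤ c s * d' t)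
    (x y : Finset V → R) (hx0 : ∀ W, 0 ≤ x W) (hy0 : ∀ W, 0 ≤ y W)
    (hxm : ∀ s t, x s ≤ x (s ∪ t)) (hym : ∀ s t, y s ≤ y (s ∪ t))
    (hmI : 0 < ∑ W ∈ U.powerset.filter (fun W => ¬ ∃ r ∈ ent ∪ ent', r ∈ W), ν W * c W)
    :
    (∑ W ∈ U.powerset.filter (fun W => ¬ ∃ r ∈ ent ∪ ent', r ∈ W), ν W * c W * y W) * ((∑ W ∈ U.powerset, ν W * chainMix ent ent' ρ c d' W) * (∑ W ∈ U.powerset, ν W * chainMix ent ent' 1 c d' W * x W) - (∑ W ∈ U.powerset, ν W * chainMix ent ent' ρ c d' W * x W) * (∑ W ∈ U.powerset, ν W * chainMix ent ent' 1 c d' W)) ≤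
      (∑ W ∈ U.powerset.filter (fun W => ¬ ∃ r ∈ ent ∪ ent', r ∈ W), ν W * c W) * ((∑ W ∈ U.powerset, ν W * chainMix ent ent' ρ c d' W) * (∑ W ∈ U.powerset, ν W * chainMix ent ent' 1 c d' W * (x W * y W)) - (∑ W ∈ U.powerset, ν W * chainMix ent ent' ρ c d' W * x W) * (∑ W ∈ U.powerset, ν W * chainMix ent ent' 1 c d' W * y W)):= by
  have hm1' : ∀ W, 0 ≤ chainMix ent ent' 1 c d' W :=
    chainMix_nonneg ent ent' zero_le_one le_rfl hc0 hd'0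
  have hmρ : ∀ W, 0 ≤ chainMix ent ent' ρ c d' W := chainMix_nonneg ent ent' hρ0 hρ1 hc0 hd'0
  have hL0 : ∀ W, 0 ≤ ν W * chainMix ent ent' ρ c d' W := fun W => mul_nonneg (hν0 W) (hmρ W)
  have hG1_0 : ∀ W, 0 ≤ ν W * chainMix ent ent' 1 c d' W := fun W => mul_nonneg (hν0 W) (hm1' W)
  have hmix' := mixture_lsm ent ent' 1 zero_le_one le_rfl c d' hc0 hd'0 hd'c hcc hd'd' hcd' hratio'
  have wMM : ∀ s ⊆ U, ∀ t ⊆ U, ν s * chainMix ent ent' 1 c d' s * (ν t * chainMix ent ent' 1 c d' t) ≤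
      ν (s ∩ t) * chainMix ent ent' 1 c d' (s ∩ t) * (ν (s ∪ t) * chainMix ent ent' 1 c d' (s ∪ t)) := by
    intro s hs t ht
    calc ν s * chainMix ent ent' 1 c d' s * (ν t * chainMix ent ent' 1 c d' t)
        = (ν s * ν t) * (chainMix ent ent' 1 c d' s * chainMix ent ent' 1 c d' t) := by ring
      _ ≤ (ν (s ∩ t) * ν (s ∪ t)) *
            (chainMix ent ent' 1 c d' (s ∩ t) * chainMix ent ent' 1 c d' (s ∪ t)) :=
          mul_le_mul (hν s hs t ht) (hmix' s t) (mul_nonneg (hm1' _) (hm1' _))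
            (mul_nonneg (hν0 _) (hν0 _))
      _ = _ := by ring
  have wML : ∀ s ⊆ U, ∀ t ⊆ U, (∃ r ∈ ent ∪ ent', r ∈ s) →
      ν s * chainMix ent ent' 1 c d' s * (ν t * chainMix ent ent' ρ c d' t) ≤
        ν (s ∩ t) * chainMix ent ent' ρ c d' (s ∩ t) * (ν (s ∪ t) * chainMix ent ent' 1 c d' (s ∪ t)) := by
    intro s hs t ht hse
    have hsu : ∃ r ∈ ent ∪ ent', r ∈ s ∪ t := by
      obtain ⟨r, hr, hrs⟩ := hse; exact ⟨r, hr, Finset.mem_union_left _ hrs⟩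
    rw [chainMix_one_of_meet ent ent' c d' hse, chainMix_one_of_meet ent ent' c d' hsu]
    calc ν s * d' s * (ν t * chainMix ent ent' ρ c d' t)
        = (ν s * ν t) * (d' s * chainMix ent ent' ρ c d' t) := by ring
      _ ≤ (ν (s ∩ t) * ν (s ∪ t)) * (chainMix ent ent' ρ c d' (s ∩ t) * d' (s ∪ t)) :=
          mul_le_mul (hν s hs t ht) (chain_cross_holley ent ent' ρ hρ0 hρ1 c d' d' hd'c hcd' hd'd' hd'0 s t)
            (mul_nonneg (hd'0 _) (hmρ _)) (mul_nonneg (hν0 _) (hν0 _))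
      _ = _ := by ring
  -- the law has positive mass (it dominates the ideal)
  have hΛ : 0 < ∑ W ∈ U.powerset, ν W * chainMix ent ent' ρ c d' W := by
    refine lt_of_lt_of_le hmI ?_
    have e : (∑ W ∈ U.powerset.filter (fun W => ¬ ∃ r ∈ ent ∪ ent', r ∈ W), ν W * c W) =
        ∑ W ∈ U.powerset.filter (fun W => ¬ ∃ r ∈ ent ∪ ent', r ∈ W),
          ν W * chainMix ent ent' ρ c d' W :=
      Finset.sum_congr rfl fun W hW => by
        rw [chainMix_of_not_meet ent ent' ρ c d' (Finset.mem_filter.1 hW).2]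
    rw [e]
    exact Finset.sum_le_sum_of_subset_of_nonneg (Finset.filter_subset _ _) fun W _ _ => hL0 W
  have hTC := tau_cake_of_holley U (ent ∪ ent') (fun W => ν W * chainMix ent ent' ρ c d' W)
    (fun W => ν W * chainMix ent ent' 1 c d' W) x y hL0 hG1_0 hx0 hy0 hxm hym wMM wML hΛ
  beta_reduce at hTC
  have hfilt : U.powerset.filter (fun W => W ∩ (ent ∪ ent') = ∅) =
      U.powerset.filter (fun W => ¬ ∃ r ∈ ent ∪ ent', r ∈ W) :=
    Finset.filter_congr fun W _ => inter_eq_empty_iff_not_meets (ent ∪ ent') W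
  have hN : (∑ W ∈ U.powerset.filter (fun W => W ∩ (ent ∪ ent') = ∅),
      ν W * chainMix ent ent' 1 c d' W) =
      ∑ W ∈ U.powerset.filter (fun W => ¬ ∃ r ∈ ent ∪ ent', r ∈ W), ν W * c W := by
    rw [hfilt]
    exact Finset.sum_congr rfl fun W hW => by
      rw [chainMix_of_not_meet ent ent' 1 c d' (Finset.mem_filter.1 hW).2]
  have hNy : (∑ W ∈ U.powerset.filter (fun W => W ∩ (ent ∪ ent') = ∅),
      ν W * chainMix ent ent' 1 c d' W * y W) =
      ∑ W ∈ U.powerset.filter (fun W => ¬ ∃ r ∈ ent ∪ ent', r ∈ W), ν W * c W * y W := by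
    rw [hfilt]
    exact Finset.sum_congr rfl fun W hW => by
      rw [chainMix_of_not_meet ent ent' 1 c d' (Finset.mem_filter.1 hW).2]
  rw [hN, hNy] at hTC
  exact hTC

/-- **THE σ-CAKE CENTRED AT THE COIN LAW `R_ρ`** (mirror of `chain_tau_cake_R`). -/
theorem chain_sigma_cake_R (U ent ent' : Finset V) (ν c d d' : Finset V → R)
    (ρ : R) (hρ0 : 0 ≤ ρ) (hρ1 : ρ ≤ 1) (hν0 : ∀ W, 0 ≤ ν W)
    (hν : ∀ s ⊆ U, ∀ t ⊆ U, ν s * ν t ≤ ν (s ∩ t) * ν (s ∪ t))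
    (hc0 : ∀ W, 0 ≤ c W) (hd0 : ∀ W, 0 ≤ d W) (hd'0 : ∀ W, 0 ≤ d' W)
    (hdc : ∀ W, d W ≤ c W) (hd'c : ∀ W, d' W ≤ c W)
    (hcc : ∀ s t, c s * c t ≤ c (s ∩ t) * c (s ∪ t))
    (hd'd' : ∀ s t, d' s * d' t ≤ d' (s ∩ t) * d' (s ∪ t))
    (hcd' : ∀ s t, c s * d' t ≤ c (s ∩ t) * d' (s ∪ t))
    (hdd' : ∀ s t, d s * d' t ≤ d (s ∩ t) * d' (s ∪ t))
    (hratio' : ∀ s t, s ⊆ t → d' s * c t ≤ c s * d' t)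
    (x y : Finset V → R) (hx0 : ∀ W, 0 ≤ x W) (hy0 : ∀ W, 0 ≤ y W)
    (hxm : ∀ s t, x s ≤ x (s ∪ t)) (hym : ∀ s t, y s ≤ y (s ∪ t))
    (hmI : 0 < ∑ W ∈ U.powerset.filter (fun W => ¬ ∃ r ∈ ent ∪ ent', r ∈ W), ν W * c W)
    :
    (∑ W ∈ U.powerset.filter (fun W => ¬ ∃ r ∈ ent ∪ ent', r ∈ W), ν W * c W * x W) * ((∑ W ∈ U.powerset, ν W * chainMix ent ent' ρ c d W) * (∑ W ∈ U.powerset, ν W * chainMix ent ent' 1 c d' W * y W) - (∑ W ∈ U.powerset, ν W * chainMix ent ent' ρ c d W * y W) * (∑ W ∈ U.powerset, ν W * chainMix ent ent' 1 c d' W)) ≤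
      (∑ W ∈ U.powerset.filter (fun W => ¬ ∃ r ∈ ent ∪ ent', r ∈ W), ν W * c W) * ((∑ W ∈ U.powerset, ν W * chainMix ent ent' ρ c d W) * (∑ W ∈ U.powerset, ν W * chainMix ent ent' 1 c d' W * (x W * y W)) - (∑ W ∈ U.powerset, ν W * chainMix ent ent' ρ c d W * y W) * (∑ W ∈ U.powerset, ν W * chainMix ent ent' 1 c d' W * x W)):= by
  have h := chain_tau_cake_R U ent ent' ν c d d' ρ hρ0 hρ1 hν0 hν hc0 hd0 hd'0 hdc hd'c hcc hd'd' hcd' hdd' hratio' y x hy0 hx0 hym hxm hmI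
  have e : (∑ W ∈ U.powerset, ν W * chainMix ent ent' 1 c d' W * (y W * x W)) =
      (∑ W ∈ U.powerset, ν W * chainMix ent ent' 1 c d' W * (x W * y W)) :=
    Finset.sum_congr rfl fun W _ => by rw [mul_comm (y W)]
  rw [e] at h
  exact h

/-- **THE σ-CAKE CENTRED AT THE GATE LAW `G_ρ`** (mirror of `chain_tau_cake_G`). -/
theorem chain_sigma_cake_G (U ent ent' : Finset V) (ν c d' : Finset V → R)
    (ρ : R) (hρ0 : 0 ≤ ρ) (hρ1 : ρ ≤ 1) (hν0 : ∀ W, 0 ≤ ν W)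
    (hν : ∀ s ⊆ U, ∀ t ⊆ U, ν s * ν t ≤ ν (s ∩ t) * ν (s ∪ t))
    (hc0 : ∀ W, 0 ≤ c W) (hd'0 : ∀ W, 0 ≤ d' W)
    (hd'c : ∀ W, d' W ≤ c W)
    (hcc : ∀ s t, c s * c t ≤ c (s ∩ t) * c (s ∪ t))
    (hd'd' : ∀ s t, d' s * d' t ≤ d' (s ∩ t) * d' (s ∪ t))
    (hcd' : ∀ s t, c s * d' t ≤ c (s ∩ t) * d' (s ∪ t))
    (hratio' : ∀ s t, s ⊆ t → d' s * c t ≤ c s * d' t)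
    (x y : Finset V → R) (hx0 : ∀ W, 0 ≤ x W) (hy0 : ∀ W, 0 ≤ y W)
    (hxm : ∀ s t, x s ≤ x (s ∪ t)) (hym : ∀ s t, y s ≤ y (s ∪ t))
    (hmI : 0 < ∑ W ∈ U.powerset.filter (fun W => ¬ ∃ r ∈ ent ∪ ent', r ∈ W), ν W * c W)
    :
    (∑ W ∈ U.powerset.filter (fun W => ¬ ∃ r ∈ ent ∪ ent', r ∈ W), ν W * c W * x W) * ((∑ W ∈ U.powerset, ν W * chainMix ent ent' ρ c d' W) * (∑ W ∈ U.powerset, ν W * chainMix ent ent' 1 c d' W * y W) - (∑ W ∈ U.powerset, ν W * chainMix ent ent' ρ c d' W * y W) * (∑ W ∈ U.powerset, ν W * chainMix ent ent' 1 c d' W)) ≤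
      (∑ W ∈ U.powerset.filter (fun W => ¬ ∃ r ∈ ent ∪ ent', r ∈ W), ν W * c W) * ((∑ W ∈ U.powerset, ν W * chainMix ent ent' ρ c d' W) * (∑ W ∈ U.powerset, ν W * chainMix ent ent' 1 c d' W * (x W * y W)) - (∑ W ∈ U.powerset, ν W * chainMix ent ent' ρ c d' W * y W) * (∑ W ∈ U.powerset, ν W * chainMix ent ent' 1 c d' W * x W)):= by
  have h := chain_tau_cake_G U ent ent' ν c d' ρ hρ0 hρ1 hν0 hν hc0 hd'0 hd'c hcc hd'd' hcd' hratio' y x hy0 hx0 hym hxm hmI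
  have e : (∑ W ∈ U.powerset, ν W * chainMix ent ent' 1 c d' W * (y W * x W)) =
      (∑ W ∈ U.powerset, ν W * chainMix ent ent' 1 c d' W * (x W * y W)) :=
    Finset.sum_congr rfl fun W _ => by rw [mul_comm (y W)]
  rw [e] at h
  exact h

end CakeLaws

end Summit.Ventures.PercRepro2.Coin
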